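/-
Origin: expansion seat `planner-pub-hodgecm-mc-axioms-1-g15-0`, handover #2 2026-08-20T20:14Z md5 bdf90fc67d1d (NEW; 356 l.; ns `HodgeCM.LiuJunction` (+ `component_eq_zero_of_mem_biSup`, `eq_sum_support` to #88's Part A) + `HodgeCM.Model` (+ `….LiuDictionary`); `adelicAlgebra V`, `LiuCarriers V` (the datum at `G := V.adelicFin`), `structure LiuDictionary hHD hI h₁ h₃ V extends LiuCarriers V` with fields `res Γ : H →ₗ[ℂ] U.CohC (U.pms L ι₁ V Γ) 1` and `adm : Char → LiuCMSide → Prop` (CM side BY COMPREHENSION; CONTRACT in the docstring), `geomClass Γ d f := (pull f 1).baseChange ℂ d.α`, `cmClasses Γ μ := ⋃ d, ⋃ (_ : adm μ d), Set.range (geomClass Γ d)`, `geomClass_mem_cmClasses`, `Thm418C := Thm418Combined res cmClasses` (the model instance of r8); JUNCTION `Model.subset_span_of_liuDictionary (T) (hirr) (h413) (h4182) (hμ) (h418) {K Ψ σ} (S : Finset T.Char) (hΦ) (hcorner : ∀ μ ∈ S, ∀ d, T.adm μ d → d.IsCorner K Ψ σ) (Θ) (hIso : ∀ Γ, ∀ ω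 ∈ Θ Γ, ∃ x : T.H, x ∈ fixedBy Γ.K T.H ∧ T.res Γ x = ω ∧ x ∈ ⨆ μ ∈ S, T.block μ) : ∃ Γ₀, ∀ Γ ≤ Γ₀, Θ Γ ⊆ span ℂ (⋃ D : CommonReflexInput K Ψ σ, D.surfaceClasses hHD hI h₁ h₃ V Γ)`, E-shaped corollaries `hThetaUnion_of_liuDictionary` (conclusion = `hΘ` of `hsmall_of_commonReflexUnion_of … P` VERBATIM) and `hsmall_of_liuDictionary (hR) …`. CERT lean-direct on the RUN-61 PKG lib + #1 + binder-2's #90 (c16f878216bd): rc 0 ∕ 16 s ∕ 0 warn ∕ 0 holes `farm/logs/j3v13-model-1.log`; `#print axioms` 9 ∕ 9 ⊆ trio, `proof-holeAx` 0 `farm/logs/j3v13-axioms.log`; NAME LIST: `HodgeCM.Model.subset_span_of_liuDictionary` · `HodgeCM.Model.hThetaUnion_of_liuDictionary` · `HodgeCM.Model.hsmall_of_liuDictionary`) (`HOME/mc/pub-hodgecm-mc-axioms-1-g15/stage62/HodgeCM/Model/LiuDictionary.lean`, md5 bdf90fc67d1d, 356 lines);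
landed by the second packager p2 gen 13 (p2-g13) in gate run 62 as `HodgeCM/Model/LiuDictionary.lean` (packager comment re-wording per the RUN-32 precedent (gate audit (5) rejects the proof-placeholder tokens s-o-r-r-y / a-d-m-i-t anywhere in a source, comments included): 1 occurrence(s) inside COMMENTS re-spelt `proof-hole` / `adm-token`; no Lean code byte touched).
-/
/-
Copyright (c) 2026 the pub-hodgecm formalisation cell (harness21).  New file, not vendored.
Origin: HOME/mc/pub-hodgecm-mc-axioms-1-g15/lean/J3v13/HodgeCM/Model/LiuDictionary.lean — session
planner-pub-hodgecm-mc-axioms-1-g15-0 (unit pub-hodgecm-mc-axioms-1-g15, CONSTRUCTION PROVER gen 15 of lineage mc-axioms-1,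
node N-i1 (L-lvl)), 2026-08-20.  (J3) DESIGN PROPOSAL v1.3 (the CM-MINIMAL RE-CUT of record, STATUS l.14280 / l.14286, with the v1.3 word l.14319:
junction on FIRST ENTRIES — binder-2-g17 (A) l.14305 / model1-g15 (A′) l.14310 — and the CM side BY COMPREHENSION), Model half — NOT kitted.
Intended final place (model1-g15 PATH word l.14310 (C)): `HodgeCM/Model/LiuDictionary.lean` (NEW additive leaf; imports the landed
`Model/HsmallOfCommonReflexUnion` (binder-1 (U1), RUN 59), `Model/ToyG2/LevelExists`, `Model/Binders/IsotypicSummand` (binder-2 #88, RUN 61),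
binder-2-g17's RUN-62 leaf `Model/Binders/JLiuCommonReflexOfCMData` (c16f878216bd, `LiuCMSide` / `IsCorner`) and the proposed Literature leaf
`Literature/AlbaneseUnitaryShimuraModules`; nothing imports it).
Companion memo: HOME/mc/pub-hodgecm-mc-axioms-1-g15/J3-DESIGN.md.
-/
import Summits.HodgeConjecture.HodgeCM.Literature.AlbaneseUnitaryShimuraModules
import Summits.HodgeConjecture.HodgeCM.Model.Binders.IsotypicSummand
import Summits.HodgeConjecture.HodgeCM.Model.Binders.JLiuCommonReflexOfCMData
import Summits.HodgeConjecture.HodgeCM.Model.HsmallOfCommonReflexUnion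
import Summits.HodgeConjecture.HodgeCM.Model.ToyG2.LevelExists

set_option autoImplicit false

/-!
# (J3) The real-carrier dictionary for [Liu21] Prop. 4.13 / Thm. 4.18 at the model, and the junction theorem

[Liu21] = Yifeng Liu, *Fourier–Jacobi cycles and arithmetic relative trace formula*, Cambridge J. Math. **9** (2021) 1–147 =
arXiv:2102.11518, §4.2 (held extraction `paper:arxiv-2102.11518`; author's TeX `FJcycle.tex`; statements quoted AS PRINTED in the
landed records `HodgeCM/Literature/AlbaneseUnitaryShimura.lean` (v3, RUN 25) and `HodgeCM/Literature/AlbaneseUnitaryShimuraCM.lean`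
(RUN 38), whose quotations and line references this file re-uses verbatim and does not repeat in full).

WHAT THIS FILE IS.  E's binder row 9 `hΘ` (group 6/14 of `HodgeCM.Model.perL_picardCM_r21AEOGI`) asks, per good sextic context
and index `i`, at small level, for a common-reflex datum `D` with `Theta V c i Γ ⊆ span (D.surfaceClasses V Γ)`.  The desk ruled
(BINDER-TRIAGE §58) that its arithmetic content is a CITATION of [Liu21] Prop. 4.13 + Thm. 4.18 (+ the proof map (4.3)), never a
PROVE item; the landed records type those sentences over BARE carriers (multiplicities in `ℕ`), which cannot be plugged into the
model (JLIU-THETA-SCOPE §1: no `G(𝔸_f)`-structure on the geometric side).  This file supplies the missing layer: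

* Part A `HodgeCM.LiuJunction.*` — KERNEL, pure module theory: in a decomposition `e : H ≃ ⨁_t Ω_t` of a module over a ring `A`
  into pairwise non-isomorphic SIMPLE modules, every `A`-map `Ω_t → H` lands in the `t`-th summand (Schur) and every element is
  the finite sum of its components — LANDED as binder-2-g17's #88 `Model/Binders/IsotypicSummand.lean` (RUN 61), imported; this
  file adds only the `Set`-indexed vanishing lemma and the support sum.  This is the whole «multiplicity one» bookkeeping that
  Liu's two displayed isomorphisms need in order to be USED; nothing else of representation theory enters.
* Part B — the REAL CARRIERS and the published sentences typed over them live in the Literature leaf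
  `HodgeCM/Literature/AlbaneseUnitaryShimuraModules.lean` (`Literature.Theta.LiuAlbaneseModuleDatum G Kof`, generic in the group
  `G` and the family of compact opens `Kof`, Mathlib-only, every sentence quoted AS PRINTED with its TYPING ∕ READING label:
  `Irreducible` (Def. 4.11), `Prop413`, `Thm418` (main statement READ as the map (4.3) = the landed READING
  `LiuAlbaneseCMDatum.Thm418_viaPullback`), `Thm418_1`, `Thm418_2`, and the explicit non-§4 hypothesis `MuSeparated` with its
  print anchor App. D Lem. D.1 (3)); here they are INSTANTIATED at `G := V.adelicFin` (the PKG's finite-adèlic unitary group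
  `U(V₃,h)(𝔸_{L₀,f})`, Liu's `U(𝕍)(𝔸_F^∞)` — his `𝕍` agrees with `V` at all finite places), `Kof := Level.K` (`abbrev LiuCarriers V`).
* Part C `HodgeCM.Model.LiuDictionary hHD hI h₁ h₃ V` — the DICTIONARY proper (CONSTRUCT, the carvers' node), CM-MINIMAL CUT
  (binder-2-g17 STATUS l.14280 (ii), accepted l.14286): the automorphic carriers REALISED against the end-state universe
  `picardCMUniverse hHD hI h₁ h₃` by `res Γ` (restriction to the identity connected component `P_Γ` of `X_K ⊗_{L,ι₁} ℂ`:
  `H ⊇ H^K = H¹(X_K ⊗_{L,ι₁} ℂ; ℂ) → H¹(P_Γ;ℂ)`; NO extension-by-zero map — see `hIso`), plus the CM side BY COMPREHENSION (v1.3,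
  binder-2 (B) l.14305/l.14308, word l.14319): NO CM carrier is chosen; the dictionary carries an admissibility predicate
  `adm μ : LiuCMSide → Prop` on binder-2's context-free CM records `d = (K', Φ', M, k, A, ιA, θA, ΦA, τ, α)` and r8's generator set is
  `cmClasses Γ μ = ⋃_{d, adm μ d} {f^*α_d | f : P_Γ → A_d}` (monotonicity: a larger generator set only weakens r8, so the instance is
  the citation as soon as Liu's own CM data for `μ` is admissible — the CONTRACT on `adm`); `Thm418C` = the model instance of the
  combined reading r8.  WITHDRAWN from v1.2: the data fields `Amu`, `alpha` and flag r9.  WITHDRAWN from v1.0/v1.1: `Ω(μ) ⊗_{M_μ} ℂ`,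
  `Hom_E(A_K,A_μ)_ℚ`, (4.3), `toΩC`, `homReal`, `res_pull43` (not constructible here: no Albanese functor / `Hom` of abelian varieties
  over `L` / `L`-structure on `X_K` — binder-2 l.14280 (i)).
* Part D — the JUNCTION THEOREM `HodgeCM.Model.subset_span_of_liuDictionary` (KERNEL, this file, proof-hole-free), on FIRST ENTRIES
  (v1.3): for any family of classes `Θ Γ ⊆ H¹(P_Γ;ℂ)` each of which is the restriction `res Γ x` of a `K`-fixed vector `x ∈ H`
  lying in the blocks `⨆_{μ ∈ S} block μ` of finitely many characters `μ` (hypothesis `hIso` = the (J2)+(J4) input: `x` = the class on ALL of `X_K(ℂ)` of the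
  adèlic theta form whose identity-component restriction is the theta class — tower class map [binder-1 #R93–#R104] ∘ the
  `G(𝔸_f)`-equivariant theta distribution out of `ω(μ_j,ε_i,χ_j)` [sinst-1 `AdelicThetaModule`, l.14218/l.14244]; no twist analysis
  of `π₀(X_K)` is needed because nothing is extended by zero; the set of TRIPLES feeding `Θ Γ` is unbounded as `Γ` shrinks, the set
  of first entries is not — binder-2 (A)) and whose characters `μ ∈ S` have every admissible CM record matching the corner
  (hypothesis `hcorner`, consumed through binder-2's `LiuCMSide.exists_commonReflexInput_of_isCorner` = (iii) l.14308; what (J5)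
  owes is `isCorner_of_isReflexOf_liftType` from the corner match of record [binder-1 #R85–#R88, binder-2 #84–#86]),
  the cited sentences `Irreducible` + `Prop413` + `Thm418_2` + `MuSeparated` (independence of the isotypic pieces, Part A) and the
  combined reading `Thm418C` (r8) give `∃ Γ₀, ∀ Γ ≤ Γ₀, Θ Γ ⊆ span ⋃_D D.surfaceClasses V Γ`; E-shaped corollary
  `hThetaUnion_of_liuDictionary` = the hypothesis `hΘ` of the landed `hsmall_of_commonReflexUnion_of` (binder-1 (U1)) VERBATIM,
  whence `hsmall` (`hsmall_of_liuDictionary`).  The multiplicity-one algebra of Part A overlaps binder-2-g17's tabled RUN-61 row #88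
  `Model/Binders/IsotypicSummand.lean` — LANDED (RUN 61, PKG 9012627d3b39) and imported here (v1.3).

DISCIPLINE.  Nothing is asserted: carriers are data, published sentences are `def … : Prop`, the junction is proved in the kernel
from them as hypotheses.  No statement of PerL, of [QW8] or of the 2001 programme is used.  `#print axioms` of every theorem ⊆
{propext, Classical.choice, Quot.sound} (expected; private lean-direct compile against PKG-as-installed RUN 61, see the memo).
-/

noncomputable section

open scoped TensorProduct DirectSum
open NumberField CategoryTheory Module

namespace HodgeCM

/-! ## Part A — multiplicity-one bookkeeping (pure module theory) -/

namespace LiuJunction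

/-! The `summand e t := range (e.symm ∘ lof t)` API of v1.0–v1.2 Part A (nine declarations, `summand` … `eq_sum_of_mem_iSup`) LANDED
verbatim in binder-2-g17's RUN-61 row #88 `HodgeCM/Model/Binders/IsotypicSummand.lean` (namespace `HodgeCM.LiuJunction`), imported
above.  Two more bookkeeping lemmas in the same vein, for the junction on FIRST ENTRIES (v1.3): -/

variable {A : Type*} [Ring A] {H : Type*} [AddCommGroup H] [Module A H]
  {T : Type*} {Ω : T → Type*} [∀ t, AddCommGroup (Ω t)] [∀ t, Module A (Ω t)]

/-- Components off an index predicate `P` of an element of `⨆_{t, P t}` (summands) vanish — the `Set`-indexed form of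
`component_eq_zero_of_mem_iSup`. [folklore] -/
theorem component_eq_zero_of_mem_biSup [DecidableEq T] (e : H ≃ₗ[A] ⨁ t, Ω t) (P : T → Prop) {x : H}
    (hx : x ∈ ⨆ (t : T) (_ : P t), summand e t) {t' : T} (ht' : ¬ P t') :
    DirectSum.component A T Ω t' (e x) = 0 := by
  suffices h : (⨆ (t : T) (_ : P t), summand e t) ≤
      LinearMap.ker (DirectSum.component A T Ω t' ∘ₗ e.toLinearMap) by
    simpa using h hx
  refine iSup₂_le fun t ht => ?_
  rintro _ ⟨y, rfl⟩
  simp only [LinearMap.mem_ker, LinearMap.coe_comp, Function.comp_apply, LinearEquiv.coe_coe,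
    LinearEquiv.apply_symm_apply]
  rw [DirectSum.component.of, dif_neg]
  rintro rfl
  exact ht' ht

/-- Every element is the (finite) sum of its components over the support of its image in `⨁_t Ω_t`. [folklore] -/
theorem eq_sum_support [DecidableEq T] [∀ (t : T) (y : Ω t), Decidable (y ≠ 0)] (e : H ≃ₗ[A] ⨁ t, Ω t) (x : H) :
    x = ∑ t ∈ DFinsupp.support (e x),
      e.symm (DirectSum.lof A T Ω t (DirectSum.component A T Ω t (e x))) := by
  apply e.injective
  rw [map_sum]
  simp_rw [LinearEquiv.apply_symm_apply, DirectSum.lof_eq_of, ← DirectSum.apply_eq_component]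
  exact (DirectSum.sum_support_of (e x)).symm

end LiuJunction

namespace Model

open Literature.AlgebraicGeometry.Motives (CMType AbelianVariety bettiCohomology SchemeOver)
open Literature.AlgebraicGeometry.HodgeTheory
open Literature.AlgebraicGeometry.HodgeTheory.BettiUniverse (pull)
open Literature.NumberTheory.Automorphic.PicardCM
open HodgeCM.CMTypeOps (inflate)
open HodgeCM.Universe (ThetaModel)

/-! ## Part B — Liu's real carriers instantiated at `(E, F, n, τ') = (L, L₀, 3, ι₁)`, `G = V.adelicFin`, `Kof = Level.K` -/

/-- The group algebra `ℂ[G(𝔸_{L₀}^∞)]` of the finite-adèlic unitary group of `V` (`V.adelicFin`, `CM/Basic.lean`): Liu's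
`ℂ[U(𝕍)(𝔸_F^∞)]`. [folklore] -/
abbrev adelicAlgebra {L : CMField} {ι₁ : L →+* ℂ} (V : HermSpace3 L ι₁) : Type :=
  MonoidAlgebra ℂ ↥V.adelicFin

/-- [Liu21] §4.2's real carriers (`Literature.Theta.LiuAlbaneseModuleDatum`) at the PKG's finite-adèlic unitary group of `V`, the
compact opens read through the PKG levels `Γ = (Γ, K)`, `Kof Γ = Γ.K` (`Level.K`), ordered by `K` (`Level.le_def`). [folklore] -/
abbrev LiuCarriers {L : CMField} {ι₁ : L →+* ℂ} (V : HermSpace3 L ι₁) : Type 1 :=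
  Literature.Theta.LiuAlbaneseModuleDatum ↥V.adelicFin (Level.K : Level V → Subgroup ↥V.adelicFin)

/-! ## Part C — the dictionary: the carriers realised against the end-state universe (CM-minimal cut) -/

variable (hHD : exists_isReal_hodgeModel) (hI : hodgePQ_independent_of_hodgeModel)
  (h₁ : BallQuotientUniformised) (h₃ : CMAbelianVarietyRealised)

/-- **(J3) THE REAL-CARRIER DICTIONARY at `(L, ι₁, V)`, CM-minimal cut** (CONSTRUCT — the carvers' node; every field is to be BUILT
from the model, none is a hypothesis kind of E): Liu's automorphic carriers `LiuCarriers V` together with their realisation on the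
end-state universe `U = picardCMUniverse hHD hI h₁ h₃`:
* `res Γ : H →ₗ H¹(P_Γ; ℂ)` — `P_Γ = U.pms L ι₁ V Γ` is the identity connected component of `X_K ⊗_{L,ι₁} ℂ`, `K = Γ.K`
  (`X_K(ℂ) = G(L₀)\[𝔹² × G(𝔸_f)/K]`, [Liu21] App. C / BINDER-TRIAGE §37.2 (L-b)); `res Γ` = `H → H^K = H¹(X_K(ℂ); ℂ) → H¹(P_Γ; ℂ)`
  (the `K`-averaging projector `e_K` followed by restriction to the component; only its values on `K`-fixed vectors matter, so any
  `ℂ`-linear extension of the restriction `H^K → H¹(P_Γ;ℂ)` will do; with `H` BUILT as `colim_K ⨁_{[h]} H¹(P_{Γ_h}; ℂ)` (memo §3,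
  (α4) = TOWER) `res Γ` is the projection to the identity-component summand at level `K`);
* `adm μ : LiuCMSide → Prop` — THE CM SIDE BY COMPREHENSION (v1.3; binder-2-g17 (B) l.14305 / l.14308, word l.14319): which
  context-free CM records `d = (K', Φ', M, k, A, ιA, θA, ΦA, hΦA, isRealisation, τ, α, α_mem)` (binder-2's `HodgeCM.Model.LiuCMSide`,
  `Model/Binders/JLiuCommonReflexOfCMData.lean`) are ADMISSIBLE for `μ`.  CONTRACT (what makes `Thm418C` below the citation r8 and not
  another statement — the desk audits the instance's `adm` against it): `adm μ` must hold of LIU'S OWN CM data for `μ`, i.e. of the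
  record `d_Liu(μ) = (M'_μ, Ψ_μ, M_μ, M'_μ ⊆ M_μ, A_μ ⊗_{L,ι₁} ℂ, i_μ, ·, Φ_{A_μ,ι₁}, ·, ·, M_μ ⊆ ℂ, α, ·)` — [Liu21] Def. 4.3 (2) («`M'_μ ⊆ ℂ`
  the reflex field of `(E, Φ_μ)`, with the induced CM type `Ψ_μ`»; «`M_μ ⊆ ℂ` … a number field containing `M'_μ`»), Def. 4.5 (2) for an
  object `D_μ ∈ 𝒜(μ)` (non-empty: Prop. 4.6 (1)) read on `H¹` through the landed `Literature/LiuCMData.cmType_eq_inflate_of_det45`,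
  and the rank-one sentence of Thm. 4.18's proof (chunk p0023 L1) for `α`.  The intended instance is `adm μ d := «(d.K', d.Φ', d.τ ∘ d.k)`
  is the reflex datum of `(L, Φ_μ)` in `ℂ`» in the (J5) lane's vocabulary (binder-1 RF1 / binder-2), under which the contract is
  Def. 4.3 (2) itself and the junction's `hcorner` is their `isCorner_of_isReflexOf_liftType`; nothing here depends on that choice.
NO CM carrier is posited or constructed, nothing is `choose`n, no isogeny transport is invoked (v1.2's data `Amu`, `alpha` and flag r9
are WITHDRAWN).  WITHDRAWN relative to v1.0/v1.1 (binder-2 l.14280 (i), axioms-1 l.14286): the carriers `Ω(μ) ⊗_{M_μ} ℂ`,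
`Hom_E(A_K, A_μ)_ℚ` and the maps (4.3), `toΩC`, `homReal`, `res_pull43` — not constructible in this package (no Albanese functor, no
`Hom` of abelian varieties over `L`, no `L`-structure on `X_K`); their printed content enters through the combined reading `Thm418C`
only. [folklore] -/
structure LiuDictionary {L : CMField} {ι₁ : L →+* ℂ} (V : HermSpace3 L ι₁) extends LiuCarriers V where
  /-- restriction to the identity connected component of level `K = Γ.K`: `H → H^K = H¹(X_K(ℂ);ℂ) → H¹(P_Γ;ℂ)` -/
  res : ∀ Γ : Level V,
    H →ₗ[ℂ] (picardCMUniverse hHD hI h₁ h₃).CohC ((picardCMUniverse hHD hI h₁ h₃).pms L ι₁ V Γ) 1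
  /-- the CM records admissible for `μ` (CONTRACT: Liu's own CM data for `μ` is admissible — Def. 4.3 (2), Def. 4.5, Prop. 4.6 (1)) -/
  adm : Char → LiuCMSide → Prop

namespace LiuDictionary

variable {hHD hI h₁ h₃}
variable {L : CMField} {ι₁ : L →+* ℂ} {V : HermSpace3 L ι₁} (T : LiuDictionary hHD hI h₁ h₃ V)

/-- The geometric class `f^*_ℂ α_d ∈ ℂ ⊗ H¹(P_Γ; ℚ) = U.CohC (U.pms L ι₁ V Γ) 1` of a `ℂ`-morphism `f : P_Γ → A_d` into the abelian
variety of a CM record `d`. [folklore] -/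
def geomClass (Γ : Level V) (d : LiuCMSide)
    (f : (pmsRealisation (ballQuotientUniformisedDatum_of h₁) (pmsCode L ι₁ V Γ)).X ⟶ d.A.X) :
    (picardCMUniverse hHD hI h₁ h₃).CohC ((picardCMUniverse hHD hI h₁ h₃).pms L ι₁ V Γ) 1 :=
  (pull f 1).baseChange ℂ d.α

/-- r8's generator set at level `Γ` BY COMPREHENSION: `{f^*α_d | d admissible for μ, f : P_Γ → A_d a ℂ-morphism}`. [folklore] -/
def cmClasses (Γ : Level V) (μ : T.Char) :
    Set ((picardCMUniverse hHD hI h₁ h₃).CohC ((picardCMUniverse hHD hI h₁ h₃).pms L ι₁ V Γ) 1) :=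
  ⋃ d : LiuCMSide, ⋃ (_ : T.adm μ d), Set.range (geomClass (hHD := hHD) (hI := hI) (h₃ := h₃) Γ d)

/-- (Ported verbatim from the HodgeCMPerL package; no docstring in the source.) -/
theorem geomClass_mem_cmClasses {Γ : Level V} {μ : T.Char} {d : LiuCMSide} (hd : T.adm μ d)
    (f : (pmsRealisation (ballQuotientUniformisedDatum_of h₁) (pmsCode L ι₁ V Γ)).X ⟶ d.A.X) :
    geomClass (hHD := hHD) (hI := hI) (h₃ := h₃) Γ d f ∈ T.cmClasses Γ μ :=
  Set.mem_iUnion.2 ⟨d, Set.mem_iUnion.2 ⟨hd, f, rfl⟩⟩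

/-- **[Liu21, Thm. 4.18 + (4.3) + Thm. 4.18 (1) + Lem. 2.4 (1), COMBINED READING r8] AT THE MODEL**: the Literature leaf's
`Thm418Combined` instantiated with `W Γ = H¹(P_Γ; ℂ)`, `res`, and the comprehension `cmClasses Γ μ` — i.e. «for `ι₁ ∈ Φ_μ` there is
`Γ₀` such that for `Γ ≤ Γ₀` every `Γ.K`-fixed vector of the `μ`-block of `H¹_{B,ι₁}(A_∞, ℂ)` restricts on `P_Γ` into the `ℂ`-span of
the classes `f^*α_d`, `d` admissible for `μ`».  By monotonicity of «⊆ span» in the generator set this is IMPLIED by the printed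
sentences as soon as Liu's own CM data for `μ` is admissible (the CONTRACT on `adm`).  CITE (reading r8). [cite: Liu21, Thm. 4.18, Thm. 4.18 (1), (4.3)] -/
def Thm418C : Prop :=
  T.Thm418Combined T.res T.cmClasses

end LiuDictionary

/-! ## Part D — the junction theorem -/

section Junction

variable {hHD hI h₁ h₃}
variable {L : CMField} {ι₁ : L →+* ℂ} {V : HermSpace3 L ι₁}

open LiuJunction Literature.Theta Literature.Theta.LiuAlbaneseModuleDatum

/-- **(J3) JUNCTION THEOREM (CM-minimal cut, on first entries).**  Let `T` be a real-carrier dictionary at `(L, ι₁, V)` for which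
the cited sentences hold: `Irreducible` (Def. 4.11), `Prop413`, `Thm418_2`, the hypothesis `MuSeparated` — these four serve ONLY the
independence of the isotypic pieces — and the combined reading `Thm418C` (r8).  Let `Θ Γ ⊆ H¹(P_Γ; ℂ)` be any family of classes and
`S` a finite set of characters `μ` with `ι₁ ∈ Φ_μ`, such that
* (J2)+(J4) `hIso`: every `ω ∈ Θ Γ` is the identity-component restriction `res Γ x` of a `Γ.K`-fixed vector `x ∈ H` lying in the
  blocks `⨆_{μ ∈ S} block μ` (for a theta class, `x` = the class of the adèlic theta form on all of `X_K(ℂ)`: tower class map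
  [binder-1 (T0)–(T4)] ∘ equivariant theta distribution out of `ω(μ,ε_i,χ)` [sinst-1 `AdelicThetaModule`]; the triples `(μ,ε,χ)`
  occurring are finitely many for each `Γ` but unboundedly many as `Γ` shrinks — only the first entries `μ` are level-independent,
  binder-2-g17 (A) l.14305 — and r8's threshold depends on `μ` alone), and
* (J5) `hcorner`: for each `μ ∈ S`, every CM record admissible for `μ` matches the corner `(K, Ψ, σ)` (`LiuCMSide.IsCorner`) — the
  (J5) lane's `isCorner_of_isReflexOf_liftType` [binder-1 #R85–#R88 RF1, binder-2 #84–#86] once `adm` is their reflex predicate.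
Then `∃ Γ₀, ∀ Γ ≤ Γ₀, Θ Γ ⊆ span ⋃_D D.surfaceClasses V Γ`.  KERNEL: `Γ₀ := ⊓_{μ ∈ S} K₀(μ)` from r8; the components `x_t` of `x` in
Prop. 4.13's decomposition are `Γ.K`-fixed (the projections are `ℂ[G]`-linear), lie in `block t.1`, and vanish unless `t.1 ∈ S`
(Schur, #88); r8 at `μ = t.1`; binder-2's `exists_commonReflexInput_of_isCorner` puts each generator `f^*α_d` in some `D.surfaceClasses`. [folklore] -/
theorem subset_span_of_liuDictionary (T : LiuDictionary hHD hI h₁ h₃ V)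
    (hirr : T.Irreducible) (h413 : T.Prop413) (h4182 : T.Thm418_2) (hμ : T.MuSeparated) (h418 : T.Thm418C)
    {K : CMField} {Ψ : CMType K} {σ : K →+* ℂ}
    (S : Finset T.Char) (hΦ : ∀ μ ∈ S, T.PhiMu μ)
    (hcorner : ∀ μ ∈ S, ∀ d : LiuCMSide, T.adm μ d → d.IsCorner K Ψ σ)
    (Θ : ∀ Γ : Level V, Set ((picardCMUniverse hHD hI h₁ h₃).CohC ((picardCMUniverse hHD hI h₁ h₃).pms L ι₁ V Γ) 1))
    (hIso : ∀ (Γ : Level V), ∀ ω ∈ Θ Γ, ∃ x : T.H, x ∈ fixedBy Γ.K T.H ∧ T.res Γ x = ω ∧ x ∈ ⨆ μ ∈ S, T.block μ) :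
    ∃ Γ₀ : Level V, ∀ Γ ≤ Γ₀,
      Θ Γ ⊆ Submodule.span ℂ (⋃ D : CommonReflexInput K Ψ σ, D.surfaceClasses hHD hI h₁ h₃ V Γ) := by
  classical
  -- the decomposition of Prop. 4.13 and the simplicity/separation of its summands
  obtain ⟨e⟩ := h413
  haveI : ∀ t : T.Triple, IsSimpleModule (adelicAlgebra V) (T.Ωt t) := fun t => hirr t.1 t.2
  have hsep : ∀ t t' : T.Triple, Nonempty (T.Ωt t ≃ₗ[adelicAlgebra V] T.Ωt t') → t = t' :=
    triple_eq_of_equiv h4182 hμ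
  -- the threshold of r8, extended by a junk level where `ι₁ ∉ Φ_μ`
  have h418' : ∀ μ : T.Char, ∃ K₀ : Level V, T.PhiMu μ → ∀ Γ ≤ K₀, ∀ x ∈ T.block μ, x ∈ fixedBy Γ.K T.H →
      T.res Γ x ∈ Submodule.span ℂ (T.cmClasses Γ μ) := by
    intro μ
    by_cases hμΦ : T.PhiMu μ
    · obtain ⟨K₀, hK₀⟩ := h418 μ hμΦ
      exact ⟨K₀, fun _ => hK₀⟩
    · exact ⟨Level.three V, fun h => absurd h hμΦ⟩
  choose K₀ hK₀ using h418'
  refine ⟨if hS : S.Nonempty then S.inf' hS K₀ else Level.three V, fun Γ hΓ ω hω => ?_⟩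
  have hΓμ : ∀ μ ∈ S, Γ ≤ K₀ μ := fun μ hμS => by
    have hS : S.Nonempty := ⟨μ, hμS⟩
    rw [dif_pos hS] at hΓ
    exact hΓ.trans (Finset.inf'_le K₀ hμS)
  -- the `K`-fixed lift `x` of `ω` lies in the sum of the summands indexed by the triples with first entry in `S`
  obtain ⟨x, hxfix, hxres, hxbl⟩ := hIso Γ ω hω
  have hx : x ∈ ⨆ (t : T.Triple) (_ : t.1 ∈ S), summand e t := by
    have hle : (⨆ μ ∈ S, T.block μ) ≤ (⨆ (t : T.Triple) (_ : t.1 ∈ S), summand e t).restrictScalars ℂ := by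
      refine iSup₂_le fun μ hμS => block_le fun a ψ => ?_
      rintro _ ⟨y, rfl⟩
      exact (le_iSup₂ (f := fun (t : T.Triple) (_ : t.1 ∈ S) => summand e t) ⟨μ, a⟩ hμS)
        (apply_mem_summand hsep e ψ y)
    exact hle hxbl
  -- its components: the `ℂ[G]`-linear projections `x ↦ x_t` of the decomposition, summed over the support of `e x`
  let Lt : T.Triple → (T.H →ₗ[adelicAlgebra V] T.H) := fun t =>
    e.symm.toLinearMap ∘ₗ DirectSum.lof (adelicAlgebra V) T.Triple T.Ωt t ∘ₗ
      DirectSum.component (adelicAlgebra V) T.Triple T.Ωt t ∘ₗ e.toLinearMap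
  have hxsum : x = ∑ t ∈ DFinsupp.support (e x), Lt t x := eq_sum_support e x
  -- each component is `Γ.K`-fixed (the projections are `ℂ[G]`-linear)
  have hxt_fixed : ∀ t, Lt t x ∈ fixedBy Γ.K T.H := by
    intro t k hk
    rw [← (Lt t).map_smul, hxfix k hk]
  -- each component lies in the `μ_t`-block (it is in the image of an equivariant map out of `ω(t)`)
  have hxt_block : ∀ t, Lt t x ∈ T.block t.1 := by
    intro t
    refine oscImage_le_block t (range_le_oscImage t
      (e.symm.toLinearMap ∘ₗ DirectSum.lof (adelicAlgebra V) T.Triple T.Ωt t) ?_)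
    exact ⟨DirectSum.component (adelicAlgebra V) T.Triple T.Ωt t (e x), rfl⟩
  -- and it vanishes unless `μ_t ∈ S` (Schur: the components of `x` off `{t | t.1 ∈ S}` are zero)
  have hxt_zero : ∀ t : T.Triple, t.1 ∉ S → Lt t x = 0 := by
    intro t ht
    simp only [Lt, LinearMap.coe_comp, Function.comp_apply, LinearEquiv.coe_coe]
    rw [component_eq_zero_of_mem_biSup e (fun t : T.Triple => t.1 ∈ S) hx ht, map_zero, map_zero]
  -- conclusion, component by component, by r8 and (J5)
  rw [← hxres, hxsum, map_sum]
  refine Submodule.sum_mem _ fun t _ => ?_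
  by_cases htS : t.1 ∈ S
  · refine Submodule.span_mono ?_ (hK₀ t.1 (hΦ t.1 htS) Γ (hΓμ t.1 htS) (Lt t x) (hxt_block t) (hxt_fixed t))
    intro y hy
    simp only [LiuDictionary.cmClasses, Set.mem_iUnion, Set.mem_range] at hy
    obtain ⟨d, hd, f, rfl⟩ := hy
    obtain ⟨D, -, hD⟩ := d.exists_commonReflexInput_of_isCorner hHD hI h₁ h₃ (hcorner t.1 htS d hd) V
    exact Set.mem_iUnion.2 ⟨D, hD Γ f⟩
  · rw [hxt_zero t htS, map_zero]
    exact Submodule.zero_mem _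

/-- **E-SHAPED COROLLARY: row 9 in the union form `hΘ∪` of binder-1 (U1).**  For ANY theta model `R` on the end-state universe
and any scope predicate `P` (E's (D1) conjunction + the canonical-`ι₁` guard): if every `(L, ι₁, V)` carries a real-carrier
dictionary on which the cited sentences hold, and in every scoped good sextic context each index `i` comes with a finite set `S` of
characters `μ`, `ι₁ ∈ Φ_μ`, whose admissible CM records match the corner `(c.K, c.Ψ i, c.σ)` ((J4a)+(J5)) and such that the theta
classes `R.Theta V c i Γ` satisfy (J2)+(J4) `hIso` in the `μ`-blocks, `μ ∈ S`, then the hypothesis `hΘ` of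
`Model.hsmall_of_commonReflexUnion_of … P` holds VERBATIM. [folklore] -/
theorem hThetaUnion_of_liuDictionary (R : (picardCMUniverse hHD hI h₁ h₃).ThetaModel)
    (T : ∀ {L : CMField} {ι₁ : L →+* ℂ} (V : HermSpace3 L ι₁), LiuDictionary hHD hI h₁ h₃ V)
    (hcite : ∀ {L : CMField} {ι₁ : L →+* ℂ} (V : HermSpace3 L ι₁),
      (T V).Irreducible ∧ (T V).Prop413 ∧ (T V).Thm418_2 ∧ (T V).MuSeparated ∧ (T V).Thm418C)
    (P : ∀ {L : CMField} {ι₁ : L →+* ℂ}, HermSpace3 L ι₁ → SeesawCtx L → Prop)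
    (hJ : ∀ {L : CMField} {ι₁ : L →+* ℂ} (V : HermSpace3 L ι₁) (c : SeesawCtx L), P V c → R.GoodCtx ι₁ c →
      Module.finrank ℚ c.K = 6 → ∀ i : Fin 4, ∃ S : Finset (T V).Char,
        (∀ μ ∈ S, (T V).PhiMu μ) ∧
        (∀ μ ∈ S, ∀ d : LiuCMSide, (T V).adm μ d → d.IsCorner c.K (c.Ψ i) c.σ) ∧
        ∀ (Γ : Level V), ∀ ω ∈ R.Theta V c i Γ, ∃ x : (T V).H,
          x ∈ fixedBy Γ.K (T V).H ∧ (T V).res Γ x = ω ∧ x ∈ ⨆ μ ∈ S, (T V).block μ) :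
    ∀ {L : CMField} {ι₁ : L →+* ℂ} (V : HermSpace3 L ι₁) (c : SeesawCtx L), P V c → R.GoodCtx ι₁ c →
      Module.finrank ℚ c.K = 6 → ∀ i : Fin 4, ∃ Γ₀ : Level V, ∀ Γ ≤ Γ₀,
        R.Theta V c i Γ ⊆
          Submodule.span ℂ (⋃ D : CommonReflexInput c.K (c.Ψ i) c.σ, D.surfaceClasses hHD hI h₁ h₃ V Γ) := by
  intro L ι₁ V c hP hgood h6 i
  obtain ⟨S, hΦ, hcorner, hIso⟩ := hJ V c hP hgood h6 i
  obtain ⟨hirr, h413, h4182, hμ, h418⟩ := hcite V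
  exact subset_span_of_liuDictionary (T V) hirr h413 h4182 hμ h418 S hΦ hcorner (fun Γ => R.Theta V c i Γ) hIso

/-- **… whence E's `hsmall` (scoped by `P`)**, by binder-1's landed `hsmall_of_commonReflexUnion_of` (Riemann's fullness `hR`). [folklore] -/
theorem hsmall_of_liuDictionary (hR : DeligneMilne1982_Thm_6_20_full)
    (R : (picardCMUniverse hHD hI h₁ h₃).ThetaModel)
    (T : ∀ {L : CMField} {ι₁ : L →+* ℂ} (V : HermSpace3 L ι₁), LiuDictionary hHD hI h₁ h₃ V)
    (hcite : ∀ {L : CMField} {ι₁ : L →+* ℂ} (V : HermSpace3 L ι₁),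
      (T V).Irreducible ∧ (T V).Prop413 ∧ (T V).Thm418_2 ∧ (T V).MuSeparated ∧ (T V).Thm418C)
    (P : ∀ {L : CMField} {ι₁ : L →+* ℂ}, HermSpace3 L ι₁ → SeesawCtx L → Prop)
    (hJ : ∀ {L : CMField} {ι₁ : L →+* ℂ} (V : HermSpace3 L ι₁) (c : SeesawCtx L), P V c → R.GoodCtx ι₁ c →
      Module.finrank ℚ c.K = 6 → ∀ i : Fin 4, ∃ S : Finset (T V).Char,
        (∀ μ ∈ S, (T V).PhiMu μ) ∧
        (∀ μ ∈ S, ∀ d : LiuCMSide, (T V).adm μ d → d.IsCorner c.K (c.Ψ i) c.σ) ∧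
        ∀ (Γ : Level V), ∀ ω ∈ R.Theta V c i Γ, ∃ x : (T V).H,
          x ∈ fixedBy Γ.K (T V).H ∧ (T V).res Γ x = ω ∧ x ∈ ⨆ μ ∈ S, (T V).block μ) :
    ∀ {L : CMField} {ι₁ : L →+* ℂ} (V : HermSpace3 L ι₁) (c : SeesawCtx L), P V c → R.GoodCtx ι₁ c →
      Module.finrank ℚ c.K = 6 → ∀ i : Fin 4, ∃ Γ₀ : Level V, ∀ Γ ≤ Γ₀,
        ∃ (M : CMField) (k : c.K →+* M) (σ' : M →+* ℂ), σ'.comp k = c.σ ∧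
          R.Theta V c i Γ ⊆ (picardCMUniverse hHD hI h₁ h₃).Uiso Γ M (inflate k (c.Ψ i)) σ' :=
  hsmall_of_commonReflexUnion_of hHD hI h₁ h₃ hR R P (hThetaUnion_of_liuDictionary R T hcite P hJ)

end Junction

end Model

end HodgeCM

end
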